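import Summits.CriticalPhenomena.PercolationContinuityZ3.Theorems.PercNearOneGluingNoHeavyLowerTailLonelyRelay
import HarnessLib

/-!
# `NoHeavyLowerTail` (stmt-CriticalPhenomena-4575) — the QUANTITATIVE GAP form of the lonely relay lemma
# (candidate QG_j of lemma factory `prim-lf-8`, PROVED at level `j = 1`)

Support file (prover `prim-lf-8`, technique "tie/glue-locus exclusion"; `--supports stmt-CriticalPhenomena-4575`).
No definitions, no named facts, no sorries.

`μ = prodBernoulli w` on `Fin n`, observer `o`, relays `A`, `N = |{a ∈ A : o ↔ a}|`, `D_a = {a ↮ A ∖ a}`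
(`a` isolated from the other relays; at level `1` this is the lightness event `|π(a)| ≤ 1`).  The lonely relay lemma
(`Theorems.lonelyRelay`, Kozma–Nitzan Lemma 2) is `μ(N = 1) ≤ max_a μ(D_a)`; the cumulative isolation lemma CIL_j
(`stub_cumulativeIsolation`, the crux's residual) is its level-`j` version.  The lemma factory's candidate
**QG_j** ("CIL is STRICT off the tie ∪ glue locus"): for a champion `c` (maximal lightness) and the runner-up value
`S₂ = max_{a ≠ c} μ(light_a)`,
  `μ(1 ≤ N ≤ j) ≤ μ(o ↔ c)·μ(light_c) + μ(o ↮ c)·S₂`,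
i.e. the CIL margin is at least `(S_c − S₂)·μ(o ↮ c)` — equality exactly on the census's tie/glue locus.  This file
PROVES the level-1 case for every `|A|` and every weighted graph:

* `quantGapOne_le_of_pairSep_pos`, `quantGapOne_of_terminalSeparation` — abstract forms (terminal separation /
  weight continuity as hypotheses, as in `…LonelyRelay`), conclusion `μ(N=1) ≤ t + max(μ(D_c) − t, 0)·μ(o ↔ c)`
  whenever `μ(D_a) ≤ t` for all `a ≠ c`;
* `quantGapOne` — unconditional: for `c ∈ A` with `μ(D_a) ≤ t ≤ μ(D_c)` for all `a ∈ A ∖ c`,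
  `μ(N = 1) ≤ μ(o ↔ c)·μ(D_c) + (1 − μ(o ↔ c))·t`.
Proof = the tree's proof of the lonely relay lemma (cover, BHK 2006 Thm 1.3 terminal separation, disjointness of
the fingers on the pairwise-separated event `M`) keeping the champion's term separate, plus ONE Harris step:
`μ(o ↔ c ∩ M) ≤ μ(o ↔ c)·μ(M)` (`{o ↔ c}` increasing, `M` decreasing).  [The same two lines turn any champion-first
level-`j` packing `Σ_x μ(top = x, 1 ≤ N ≤ j)/μ(light_x) ≤ 1` into QG_j.]
-/

noncomputable section

namespace Summit.CriticalPhenomena.PercolationContinuityZ3.Theorems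

open MeasureTheory Set Filter Topology Literature.Probability.LatticeModels Literature.Probability.Percolation
open scoped Classical BigOperators Topology

/-- The pairwise-separation event of a vertex set is decreasing. [folklore] -/
theorem quantGapOne_isLowerSet_pairSep {n : ℕ} (A : Finset (Fin n)) :
    IsLowerSet {ω : Set (Sym2 (Fin n)) | ∀ x ∈ A, ∀ y ∈ A, x ≠ y → ω ∉ openConn x y} := by
  intro ω ω' hle hω x hx y hy hxy h
  exact hω x hx y hy hxy (isUpperSet_openConn x y hle h)

/-- **Quantitative gap form of the lonely relay lemma, non-null separation event.**  Under terminal separation: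
if `0 ≤ t`, `μ(D_a) ≤ t` for every relay `a ≠ c` and `μ(M) > 0` (`M` = `A` pairwise separated), then
`μ(N = 1) ≤ t + max(μ(D_c) − t, 0)·μ(o ↔ c)`.
[cite: KozmaNitzan2024, Lemma 2 (p. 6) — singleton blocks, champion term kept; + Harris] -/
theorem quantGapOne_le_of_pairSep_pos
    (hTS : ∀ (n : ℕ) (w : Sym2 (Fin n) → unitInterval) (T : Finset (Fin n)) (o a : Fin n),
      (prodBernoulli w).real (openConn o a ∩ {ω | ∀ t ∈ T, ω ∉ openConn a t}) *
        (prodBernoulli w).real ({ω | ∀ t ∈ T, ω ∉ openConn a t} ∩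
            {ω | ∀ t ∈ T, ∀ t' ∈ T, t ≠ t' → ω ∉ openConn t t'}) ≤
      (prodBernoulli w).real {ω | ∀ t ∈ T, ω ∉ openConn a t} *
        (prodBernoulli w).real (openConn o a ∩ ({ω | ∀ t ∈ T, ω ∉ openConn a t} ∩
              {ω | ∀ t ∈ T, ∀ t' ∈ T, t ≠ t' → ω ∉ openConn t t'})))
    {n : ℕ} (w : Sym2 (Fin n) → unitInterval) (A : Finset (Fin n)) (o c : Fin n) (hc : c ∈ A) (t : ℝ)
    (ht : 0 ≤ t)
    (hiso : ∀ a ∈ A, a ≠ c → (prodBernoulli w).real {ω | ∀ t ∈ A.erase a, ω ∉ openConn a t} ≤ t)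
    (hM : 0 < (prodBernoulli w).real
      {ω : Set (Sym2 (Fin n)) | ∀ x ∈ A, ∀ y ∈ A, x ≠ y → ω ∉ openConn x y}) :
    (prodBernoulli w).real
        {ω : Set (Sym2 (Fin n)) | (A.filter fun a => ω ∈ openConn o a).card = 1} ≤
      t + max ((prodBernoulli w).real {ω | ∀ t ∈ A.erase c, ω ∉ openConn c t} - t) 0 *
        (prodBernoulli w).real (openConn o c) := by
  set μ := prodBernoulli w with hμ
  set M : Set (Set (Sym2 (Fin n))) := {ω | ∀ x ∈ A, ∀ y ∈ A, x ≠ y → ω ∉ openConn x y} with hMdef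
  set D : Fin n → Set (Set (Sym2 (Fin n))) := fun a => {ω | ∀ t ∈ A.erase a, ω ∉ openConn a t} with hDdef
  -- (1) cover and union bound
  have h1 : μ.real {ω : Set (Sym2 (Fin n)) | (A.filter fun a => ω ∈ openConn o a).card = 1} ≤
      ∑ a ∈ A, μ.real (openConn o a ∩ D a) :=
    (measureReal_mono (lonelyRelay_subset_biUnion A o) (measure_ne_top _ _)).trans
      (measureReal_biUnion_finset_le A _)
  -- (2) terminal separation, term by term
  have h2 : ∀ a ∈ A, μ.real (openConn o a ∩ D a) * μ.real M ≤ μ.real (D a) * μ.real (openConn o a ∩ M) := by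
    intro a ha
    have key := hTS n w (A.erase a) o a
    rw [singleFinger_sep_inter_pairSep_eq A ha] at key
    exact key
  -- (3) disjointness of the events `{o ↔ a} ∩ M`
  have h3 : ∑ a ∈ A, μ.real (openConn o a ∩ M) ≤ μ.real M := by
    rw [← measureReal_biUnion_finset
      (singleFinger_pairwiseDisjoint_conn_inter_pairSep A A o subset_rfl)
      (fun a _ => MeasurableSet.of_discrete)]
    exact measureReal_mono (Set.iUnion₂_subset fun a _ => Set.inter_subset_right)
  -- (4) Harris for the champion's finger: `{o ↔ c}` increasing, `M` decreasing
  have h4 : μ.real (openConn o c ∩ M) ≤ μ.real (openConn o c) * μ.real M :=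
    prodBernoulli_harris_upper_lower w (isUpperSet_openConn o c) (quantGapOne_isLowerSet_pairSep A)
      MeasurableSet.of_discrete MeasurableSet.of_discrete
  -- (5) bookkeeping: split off the champion's term
  have hθ0 : 0 ≤ μ.real (openConn o c ∩ M) := measureReal_nonneg
  have hsplit : ∑ a ∈ A, μ.real (D a) * μ.real (openConn o a ∩ M) ≤
      μ.real (D c) * μ.real (openConn o c ∩ M) + t * (μ.real M - μ.real (openConn o c ∩ M)) := by
    rw [← Finset.add_sum_erase A _ hc]
    have hrest : ∑ a ∈ A.erase c, μ.real (D a) * μ.real (openConn o a ∩ M) ≤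
        ∑ a ∈ A.erase c, t * μ.real (openConn o a ∩ M) := by
      refine Finset.sum_le_sum fun a ha => ?_
      obtain ⟨hac, haA⟩ := Finset.mem_erase.1 ha
      exact mul_le_mul_of_nonneg_right (hiso a haA hac) measureReal_nonneg
    have hsum : ∑ a ∈ A.erase c, μ.real (openConn o a ∩ M) = 
        ∑ a ∈ A, μ.real (openConn o a ∩ M) - μ.real (openConn o c ∩ M) := by
      rw [← Finset.add_sum_erase A _ hc]; ring
    have hrest' : ∑ a ∈ A.erase c, t * μ.real (openConn o a ∩ M) ≤
        t * (μ.real M - μ.real (openConn o c ∩ M)) := by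
      rw [← Finset.mul_sum, hsum]
      exact mul_le_mul_of_nonneg_left (by linarith) ht
    linarith
  -- (6) assemble: `μ{N=1}·μ(M) ≤ [t + max(μ(D c) − t, 0)·μ(o ↔ c)]·μ(M)`
  have h5 : (∑ a ∈ A, μ.real (openConn o a ∩ D a)) * μ.real M ≤
      (t + max (μ.real (D c) - t) 0 * μ.real (openConn o c)) * μ.real M := by
    rw [Finset.sum_mul]
    have hmax0 : 0 ≤ max (μ.real (D c) - t) 0 := le_max_right _ _
    have hmax1 : μ.real (D c) - t ≤ max (μ.real (D c) - t) 0 := le_max_left _ _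
    calc ∑ a ∈ A, μ.real (openConn o a ∩ D a) * μ.real M
        ≤ ∑ a ∈ A, μ.real (D a) * μ.real (openConn o a ∩ M) := Finset.sum_le_sum h2
      _ ≤ μ.real (D c) * μ.real (openConn o c ∩ M) + t * (μ.real M - μ.real (openConn o c ∩ M)) := hsplit
      _ = t * μ.real M + (μ.real (D c) - t) * μ.real (openConn o c ∩ M) := by ring
      _ ≤ t * μ.real M + max (μ.real (D c) - t) 0 * μ.real (openConn o c ∩ M) := by
          nlinarith
      _ ≤ t * μ.real M + max (μ.real (D c) - t) 0 * (μ.real (openConn o c) * μ.real M) := by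
          nlinarith
      _ = (t + max (μ.real (D c) - t) 0 * μ.real (openConn o c)) * μ.real M := by ring
  exact h1.trans (le_of_mul_le_mul_right h5 hM)

/-- **Quantitative gap form of the lonely relay lemma, abstract form** (terminal separation and weight continuity
as hypotheses): `0 ≤ t` and `μ(D_a) ≤ t` for all `a ∈ A ∖ c` imply `μ(N = 1) ≤ t + max(μ(D_c) − t, 0)·μ(o ↔ c)`.
[cite: KozmaNitzan2024, Lemma 2 (p. 6) — singleton blocks; + Harris] -/
theorem quantGapOne_of_terminalSeparation
    (hTS : ∀ (n : ℕ) (w : Sym2 (Fin n) → unitInterval) (T : Finset (Fin n)) (o a : Fin n),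
      (prodBernoulli w).real (openConn o a ∩ {ω | ∀ t ∈ T, ω ∉ openConn a t}) *
        (prodBernoulli w).real ({ω | ∀ t ∈ T, ω ∉ openConn a t} ∩
            {ω | ∀ t ∈ T, ∀ t' ∈ T, t ≠ t' → ω ∉ openConn t t'}) ≤
      (prodBernoulli w).real {ω | ∀ t ∈ T, ω ∉ openConn a t} *
        (prodBernoulli w).real (openConn o a ∩ ({ω | ∀ t ∈ T, ω ∉ openConn a t} ∩
              {ω | ∀ t ∈ T, ∀ t' ∈ T, t ≠ t' → ω ∉ openConn t t'})))
    (hcont : ∀ (n : ℕ) (E : Set (BondConfig (Fin n))),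
      Continuous fun w : Sym2 (Fin n) → unitInterval => (prodBernoulli w).real E)
    (n : ℕ) (w : Sym2 (Fin n) → unitInterval) (A : Finset (Fin n)) (o c : Fin n) (hc : c ∈ A) (t : ℝ)
    (ht : 0 ≤ t)
    (hiso : ∀ a ∈ A, a ≠ c → (prodBernoulli w).real {ω | ∀ t ∈ A.erase a, ω ∉ openConn a t} ≤ t) :
    (prodBernoulli w).real
        {ω : Set (Sym2 (Fin n)) | (A.filter fun a => ω ∈ openConn o a).card = 1} ≤
      t + max ((prodBernoulli w).real {ω | ∀ t ∈ A.erase c, ω ∉ openConn c t} - t) 0 *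
        (prodBernoulli w).real (openConn o c) := by
  -- the scaled weights `w_k = (1 - 1/(k+1)) • w`, all `< 1`, converging to `w` (as in `…LonelyRelay`)
  have hcmem : ∀ k : ℕ, ((1 : ℝ) - 1 / ((k : ℝ) + 1)) ∈ unitInterval := by
    intro k
    have hk : (0 : ℝ) < (k : ℝ) + 1 := Nat.cast_add_one_pos k
    have h1 : 1 / ((k : ℝ) + 1) ≤ 1 := by
      rw [div_le_one hk]; linarith [(Nat.cast_nonneg k : (0 : ℝ) ≤ k)]
    have h0 : 0 ≤ 1 / ((k : ℝ) + 1) := by positivity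
    exact ⟨by linarith, by linarith⟩
  set wk : ℕ → Sym2 (Fin n) → unitInterval :=
    fun k e => ⟨(1 - 1 / ((k : ℝ) + 1)) * (w e : ℝ), unitInterval.mul_mem (hcmem k) (w e).2⟩
    with hwk_def
  have hwk_lt : ∀ k e, ((wk k e : unitInterval) : ℝ) < 1 := by
    intro k e
    have hk : (0 : ℝ) < (k : ℝ) + 1 := Nat.cast_add_one_pos k
    have hc' : (1 : ℝ) - 1 / ((k : ℝ) + 1) < 1 := by
      have : 0 < 1 / ((k : ℝ) + 1) := by positivity
      linarith
    calc ((wk k e : unitInterval) : ℝ) = (1 - 1 / ((k : ℝ) + 1)) * (w e : ℝ) := rfl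
      _ ≤ (1 - 1 / ((k : ℝ) + 1)) := mul_le_of_le_one_right (hcmem k).1 (w e).2.2
      _ < 1 := hc'
  have hc_lim : Tendsto (fun k : ℕ => (1 : ℝ) - 1 / ((k : ℝ) + 1)) atTop (𝓝 1) := by
    simpa using tendsto_const_nhds.sub (tendsto_one_div_add_atTop_nhds_zero_nat (𝕜 := ℝ))
  have hwk_lim : Tendsto wk atTop (𝓝 w) := by
    refine tendsto_pi_nhds.2 fun e => ?_
    rw [tendsto_subtype_rng]
    have h := hc_lim.mul_const (w e : ℝ)
    rw [one_mul] at h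
    exact h
  have hlimE : ∀ E : Set (Set (Sym2 (Fin n))),
      Tendsto (fun k => (prodBernoulli (wk k)).real E) atTop (𝓝 ((prodBernoulli w).real E)) :=
    fun E => ((hcont n E).tendsto w).comp hwk_lim
  -- the error terms `δ k = ∑_{a ∈ A} |μ_{w_k}(D_a) - μ_w(D_a)| → 0`
  set δ : ℕ → ℝ := fun k => ∑ a ∈ A,
      |(prodBernoulli (wk k)).real {ω | ∀ t ∈ A.erase a, ω ∉ openConn a t} -
        (prodBernoulli w).real {ω | ∀ t ∈ A.erase a, ω ∉ openConn a t}|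
    with hδ_def
  have hδ_lim : Tendsto δ atTop (𝓝 0) := by
    have h : ∀ a ∈ A, Tendsto (fun k =>
        |(prodBernoulli (wk k)).real {ω | ∀ t ∈ A.erase a, ω ∉ openConn a t} -
          (prodBernoulli w).real {ω | ∀ t ∈ A.erase a, ω ∉ openConn a t}|)
        atTop (𝓝 0) := by
      intro a _
      simpa using (tendsto_sub_nhds_zero_iff.2
        (hlimE {ω | ∀ t ∈ A.erase a, ω ∉ openConn a t})).abs
    simpa [hδ_def] using tendsto_finsetSum A h
  have hδ_ge : ∀ k, ∀ a ∈ A,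
      |(prodBernoulli (wk k)).real {ω | ∀ t ∈ A.erase a, ω ∉ openConn a t} -
          (prodBernoulli w).real {ω | ∀ t ∈ A.erase a, ω ∉ openConn a t}| ≤ δ k := by
    intro k a ha
    exact Finset.single_le_sum (f := fun a =>
        |(prodBernoulli (wk k)).real {ω | ∀ t ∈ A.erase a, ω ∉ openConn a t} -
          (prodBernoulli w).real {ω | ∀ t ∈ A.erase a, ω ∉ openConn a t}|)
        (fun a _ => abs_nonneg _) ha
  -- the bound at each `k` (all weights `< 1`, so the separation event is non-null), with `t + δ k`
  have hk : ∀ k, (prodBernoulli (wk k)).real {ω : Set (Sym2 (Fin n)) |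
      (A.filter fun a => ω ∈ openConn o a).card = 1} ≤
        (t + δ k) + max ((prodBernoulli (wk k)).real {ω | ∀ t ∈ A.erase c, ω ∉ openConn c t} - (t + δ k)) 0 *
          (prodBernoulli (wk k)).real (openConn o c) := by
    intro k
    have hδk : 0 ≤ δ k := Finset.sum_nonneg fun a _ => abs_nonneg _
    refine quantGapOne_le_of_pairSep_pos hTS (wk k) A o c hc (t + δ k) (by linarith) ?_
      (singleFinger_pairSep_real_pos (wk k) (hwk_lt k) _)
    intro a ha hac
    have h1 := hiso a ha hac
    have h2 := hδ_ge k a ha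
    have h3 := le_abs_self
      ((prodBernoulli (wk k)).real {ω | ∀ t ∈ A.erase a, ω ∉ openConn a t} -
        (prodBernoulli w).real {ω | ∀ t ∈ A.erase a, ω ∉ openConn a t})
    linarith
  -- pass to the limit `k → ∞`
  have hlimR : Tendsto (fun k => (t + δ k) +
      max ((prodBernoulli (wk k)).real {ω | ∀ t ∈ A.erase c, ω ∉ openConn c t} - (t + δ k)) 0 *
        (prodBernoulli (wk k)).real (openConn o c)) atTop
      (𝓝 (t + max ((prodBernoulli w).real {ω | ∀ t ∈ A.erase c, ω ∉ openConn c t} - t) 0 *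
        (prodBernoulli w).real (openConn o c))) := by
    have ht' : Tendsto (fun k => t + δ k) atTop (𝓝 t) := by
      simpa using tendsto_const_nhds.add hδ_lim
    have hmax : Tendsto (fun k =>
        max ((prodBernoulli (wk k)).real {ω | ∀ t ∈ A.erase c, ω ∉ openConn c t} - (t + δ k)) 0) atTop
        (𝓝 (max ((prodBernoulli w).real {ω | ∀ t ∈ A.erase c, ω ∉ openConn c t} - t) 0)) :=
      ((hlimE _).sub ht').max tendsto_const_nhds
    exact ht'.add (hmax.mul (hlimE _))
  exact le_of_tendsto_of_tendsto' (hlimE _) hlimR hk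

/-- **THE QUANTITATIVE GAP FORM OF THE LONELY RELAY LEMMA** (all `|A|`, unconditional).  For bond percolation
with arbitrary edge probabilities on `Fin n`, an observer `o`, relays `A`, a relay `c ∈ A` and a threshold `t ≥ 0` with
`μ(a ↮ A∖a) ≤ t ≤ μ(c ↮ A∖c)` for every `a ∈ A ∖ c` (e.g. `c` the loneliest relay and `t` the runner-up value):
  `μ(N = 1) ≤ μ(o ↔ c)·μ(c ↮ A∖c) + (1 − μ(o ↔ c))·t`.
So the lonely relay bound `μ(N=1) ≤ μ(c ↮ A∖c)` is strict by at least `(μ(c ↮ A∖c) − t)·μ(o ↮ c)`: equality forces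
a championship tie or `o` glued to the champion.  Kozma–Nitzan's Lemma 2 packing + one Harris step.
[cite: KozmaNitzan2024, Lemma 2 (p. 6); VandenbergHaggstromKahn2005, Thm. 1.3] -/
theorem quantGapOne (n : ℕ) (w : Sym2 (Fin n) → unitInterval) (A : Finset (Fin n)) (o c : Fin n)
    (hc : c ∈ A) (t : ℝ) (ht : 0 ≤ t)
    (hiso : ∀ a ∈ A, a ≠ c → (prodBernoulli w).real {ω | ∀ t ∈ A.erase a, ω ∉ openConn a t} ≤ t)
    (htc : t ≤ (prodBernoulli w).real {ω | ∀ t ∈ A.erase c, ω ∉ openConn c t}) :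
    (prodBernoulli w).real
        {ω : Set (Sym2 (Fin n)) | (A.filter fun a => ω ∈ openConn o a).card = 1} ≤
      (prodBernoulli w).real (openConn o c) *
          (prodBernoulli w).real {ω | ∀ t ∈ A.erase c, ω ∉ openConn c t} +
        (1 - (prodBernoulli w).real (openConn o c)) * t := by
  have h := quantGapOne_of_terminalSeparation (stub_terminalSeparation ?_) stub_weightContinuity
    n w A o c hc t ht hiso
  · rw [max_eq_left (by linarith)] at h
    linarith
  · intro n w s X F G hF hG hs
    exact BHK2006_clusterConditionalPositiveAssociation_holds (Fin n) w s X F G hF hG hs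

end Summit.CriticalPhenomena.PercolationContinuityZ3.Theorems

end
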